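import Summits.Ventures.CertifiedArithmetic.LowPrec.SROptimal
import Summits.Ventures.CertifiedArithmetic.LowPrec.SRBlockScale
import Summits.Ventures.CertifiedArithmetic.LowPrec.SREscape
import HarnessLib

/-!
# Stochastic rounding in low-precision formats LXVI — RECURSIVE SR IS THE OPTIMAL UNBIASED
# ACCUMULATION: among ALL adapted, arbitrarily randomised `F`-valued summation schemes that are
# conditionally unbiased at every step, CHM stochastic rounding minimises `E f(ŝₙ − sₙ)` for EVERY
# convex `f`, every `n` and every input sequence, inside a no-saturation corridor

HONEST FRAMING: certified error envelopes and provably optimal rounding/accumulation schemes for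
low-precision formats under stated cost models; every table by two implementations; no hardware or
vendor claims.

File LV (`LowPrec/SROptimal`, `step_le_law`) settled ONE rounding: among all `F`-valued randomised
roundings of `c` with mean `c`, SR minimises every convex functional.  This file settles the
`n`-STEP ACCUMULATION `ŝ₀ = s`, `ŝₖ₊₁ = round(ŝₖ + xₖ)` against the widest natural class of
competitors; the companion file `LowPrec/SRAccumulationOptimalLedger` shows that the class is exactly
the unbiased schemes, that SR belongs to it and attains the bound, and carries the FP4 ledger.

THE CLASS (`Scheme`, `Adm`).  A competitor is ANY scheme that, at step `k`, having seen the whole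
history of its own states, draws the next state `ŝₖ₊₁ ∈ F` from an ARBITRARY probability vector
`w` on `F` (any support, any number of random bits, history-dependent), subject only to
(U) conditional unbiasedness `∑ w(y)·y = ŝₖ + xₖ` and (C) the support staying in a prescribed
corridor window `[aₖ₊₁, bₖ₊₁]`.  Unrolled, such a scheme is an outcome tree (`Scheme`: a node carries
its law `w : K → K` and one subtree per possible next state); `T.exp F f s = E_T f(ŝₙ)`.  Private
randomness beyond the drawn states integrates out (a mixture of admissible kernels is an admissible
kernel), so state-history-indexed trees are the general case.

THE CORRIDOR (`Corridor F a b x n`): grid points `aᵢ, bᵢ ∈ F` with `aᵢ₊₁ ≤ aᵢ + xᵢ` and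
`bᵢ + xᵢ ≤ bᵢ₊₁` — a moving window that every unbiased walk started in `[a₀, b₀]` can respect and
inside which nothing saturates (`Corridor.noSat`).  For a floating-point value set and a short sum
this is just "stay ≥ 1 ulp away from ±maxRat"; it is the exact hypothesis under which the
statements below hold, replacing the informal "no overflow".  The theorem holds for EVERY corridor;
the widest choice is canonical (remark, not formalised here): the grid states from which an
everywhere-unbiased `F`-valued continuation exists form, time slice by time slice, grid intervals
`[αᵢ, βᵢ]` satisfying exactly these two inequalities, so (C) is no restriction on a scheme that is
unbiased on every one of its branches.

MAIN THEOREM (`accExp_le_exp`).  `f` convex, `Corridor F a b x n`, `s ∈ [a₀, b₀]`, `T` admissible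
`⟹ accExp F x n f s ≤ T.exp F f s`, i.e. `E_SR f(ŝₙ) ≤ E_T f(ŝₙ)`; with `f ↦ f(· − sₙ)`
(`accExp_err_le_exp_err`) SR minimises every convex functional of the final error — variance
(`accVar_le_exp_sq`: `accVar ≤ E_T(ŝₙ − sₙ)²`), all absolute moments, stop-loss `E (ŝₙ − sₙ − t)₊`,
`E exp(λ(ŝₙ − sₙ))`, … — simultaneously, for every `n` and every input sequence.

PROOF = ONE INVARIANT (`SubgradOn`, `subgradOn_accExp`).  The SR cost-to-go
`Mⱼ(y) = E[f(ŝₙ) | ŝⱼ = y]` is in general NOT a convex function of a real variable (it is the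
iterated piecewise-linear interpolant `y ↦ E Mⱼ₊₁(SR(y + xⱼ))`, `step_eq_affine`), but it keeps a
SUPPORTING LINE AT EVERY GRID POINT of the window: (i) a convex `f` has one (`subgradOn_of_convexOn`,
finite secant extremisation — no derivative needed); (ii) grid supporting lines give, on each cell
`[⌊c⌋, ⌈c⌉]`, a CELL LINE through both endpoints' values lying below `M` on the whole window grid
(`cell_line`; uses that no grid point is strictly inside a cell, `mem_le_dn_or_up_le`); (iii) one SR
step evaluates the cell line (`step_eq_line`) while every admissible law integrates `M` above it
(`step_le_law_of_subgradOn` — the one-step comparison), and the PL interpolant lies above every cell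
line (`line_le_step`), so the property propagates backwards through a step (`subgradOn_step`).
Backward induction on the competitor's tree finishes (`accExp_le_exp`).

NOT CLAIMED: uniqueness of the minimiser for `n ≥ 2` (the FP4 ledger of the companion file has an
off-cell unbiased competitor that TIES; for one step and strictly convex `f` SR is the unique
minimiser, file LV `law_eq_sr_of_var_eq`); anything outside a corridor (at the hull boundary
unbiasedness itself fails, file LV `no_unbiased_law_of_maxRat_lt`); biased competitors
(round-to-nearest has smaller variance and is biased; the exact bias/variance frontier per step is
file LV `law_sq_eq_frontier_iff`); schemes with extra state (compensated / Kahan-SR, files XXIX ff.,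
beat plain SR by carrying a second register — they are not one-register `F`-valued schemes).
THE ONE-REGISTER LAW: with one `F`-valued register and no bias, nothing beats CHM SR, whatever the
randomisation.

Prior art: one-step minimality of SR's variance among unbiased roundings is [ZhangEtAl2016, Lem. 12]
(ZipML) and, as convex-order minimality of the two-point law, [ShakedShanthikumar2007, §3.A]; the
`n`-step statement over adaptive randomised schemes, the grid-supporting-line invariant and the
corridor hypothesis are new as far as searched ([ConnollyHighamMary2021], [CrociEtAl2022] survey,
[XiaEtAl2024arXiv], [ElArarEtAl2022arXiv]: no optimality statement for accumulation; FRESHNESS-SR L).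
-/

namespace Summit.Ventures.CertifiedArithmetic.LowPrec.SR

open Literature.ComputerArithmetic.ConnollyHighamMary2021
open Finset

/-! ### Randomised accumulation schemes as outcome trees -/

/-- A randomised `F`-valued accumulation SCHEME, unrolled as its outcome tree: `leaf` = stop (return
the current state); `node w ch` = draw the next state `y` with probability `w y` (an arbitrary
function `K → K`, constrained only by `Adm`) and continue with the subtree `ch y`.  The law and the
subtrees may depend on the entire history (they sit at a history-determined position in the tree). -/
inductive Scheme (K : Type*) where
  | leaf : Scheme K
  | node : (K → K) → (K → Scheme K) → Scheme K

variable {K : Type*} [Field K] [LinearOrder K] [IsStrictOrderedRing K]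

/-- `T.exp F f s = E_T[f(ŝₙ) | ŝ₀ = s]`: a leaf returns `f s`; a node averages its subtrees' values
over its law on `F`. -/
def Scheme.exp (F : Finset K) : Scheme K → (K → K) → K → K
  | .leaf, f, s => f s
  | .node w ch, f, _ => ∑ y ∈ F, w y * Scheme.exp F (ch y) f y

/-- ADMISSIBILITY `Adm F a b x n s T` of a scheme `T` for `n` steps with summands `x`, started at `s`,
relative to the corridor windows `[aᵢ, bᵢ]`: the tree has depth exactly `n`; every law used is a
probability vector on `F` (U) with mean `current state + xₖ` (conditional unbiasedness) and
(C) support inside the next window; only branches of positive probability are constrained. -/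
def Adm (F : Finset K) : (ℕ → K) → (ℕ → K) → (ℕ → K) → ℕ → K → Scheme K → Prop
  | _, _, _, 0, _, .leaf => True
  | _, _, _, 0, _, .node _ _ => False
  | _, _, _, _ + 1, _, .leaf => False
  | a, b, x, n + 1, s, .node w ch =>
      (∀ y ∈ F, 0 ≤ w y) ∧ (∑ y ∈ F, w y) = 1 ∧ (∑ y ∈ F, w y * y) = s + x 0 ∧
      (∀ y ∈ F, w y ≠ 0 → a 1 ≤ y ∧ y ≤ b 1) ∧
      ∀ y ∈ F, w y ≠ 0 →
        Adm F (fun i => a (i + 1)) (fun i => b (i + 1)) (fun i => x (i + 1)) n y (ch y)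

/-- A NO-SATURATION CORRIDOR for `n` steps with summands `x`: windows `[aᵢ, bᵢ]` with grid endpoints,
`aᵢ₊₁ ≤ aᵢ + xᵢ` and `bᵢ + xᵢ ≤ bᵢ₊₁` (so a state in window `i` plus `xᵢ` lands between two grid
points of window `i + 1`: no clamping, and both SR candidates stay in the corridor). -/
structure Corridor (F : Finset K) (a b x : ℕ → K) (n : ℕ) : Prop where
  lo_mem : ∀ i ≤ n, a i ∈ F
  hi_mem : ∀ i ≤ n, b i ∈ F
  lo_step : ∀ i < n, a (i + 1) ≤ a i + x i
  hi_step : ∀ i < n, b i + x i ≤ b (i + 1)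

omit [IsStrictOrderedRing K] in
/-- The corridor seen from step `1` on. -/
theorem Corridor.succ {F : Finset K} {a b x : ℕ → K} {n : ℕ} (h : Corridor F a b x (n + 1)) :
    Corridor F (fun i => a (i + 1)) (fun i => b (i + 1)) (fun i => x (i + 1)) n where
  lo_mem i hi := h.lo_mem (i + 1) (by omega)
  hi_mem i hi := h.hi_mem (i + 1) (by omega)
  lo_step i hi := h.lo_step (i + 1) (by omega)
  hi_step i hi := h.hi_step (i + 1) (by omega)

/-! ### Grid supporting lines -/

/-- `SubgradOn F lo hi M`: at every GRID point `c` of the window `[lo, hi]`, `M` has a supporting line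
valid at every grid point of the window — the discrete shadow of convexity that survives SR steps. -/
def SubgradOn (F : Finset K) (lo hi : K) (M : K → K) : Prop :=
  ∀ c ∈ F, lo ≤ c → c ≤ hi → ∃ k : K, ∀ y ∈ F, lo ≤ y → y ≤ hi → M c + (y - c) * k ≤ M y

omit [LinearOrder K] [IsStrictOrderedRing K] in
/-- `a · (b / a) = b` for `a ≠ 0`. -/
private theorem mul_div_cancel_aux {a : K} (b : K) (h : a ≠ 0) : a * (b / a) = b := by
  field_simp

/-- A convex function has a supporting line at every point of a finite set, valid on the set
(slope = the least right secant, or the greatest left secant if there is no grid point to the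
right; pure secant monotonicity, no derivatives). [folklore] -/
theorem subgradOn_of_convexOn {f : K → K} (hf : ConvexOn K Set.univ f) (F : Finset K)
    (lo hi : K) : SubgradOn F lo hi f := by
  intro c _ _ _
  by_cases hR : (F.filter (fun y => c < y)).Nonempty
  · refine ⟨(F.filter (fun y => c < y)).inf' hR (fun y => (f y - f c) / (y - c)), ?_⟩
    intro y hy _ _
    rcases lt_trichotomy c y with hcy | rfl | hyc
    · have hk : (F.filter (fun y => c < y)).inf' hR (fun y => (f y - f c) / (y - c))
          ≤ (f y - f c) / (y - c) :=
        inf'_le (fun y => (f y - f c) / (y - c)) (by simp [hy, hcy])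
      have hpos : 0 < y - c := sub_pos.mpr hcy
      have e : (y - c) * ((f y - f c) / (y - c)) = f y - f c := mul_div_cancel_aux _ hpos.ne'
      have := mul_le_mul_of_nonneg_left hk hpos.le
      rw [e] at this
      linarith
    · simp
    · have hk : (f y - f c) / (y - c)
          ≤ (F.filter (fun y => c < y)).inf' hR (fun y => (f y - f c) / (y - c)) := by
        refine le_inf' hR _ ?_
        intro z hz
        have hcz : c < z := (mem_filter.mp hz).2
        exact hf.secant_mono (Set.mem_univ c) (Set.mem_univ y) (Set.mem_univ z)
          hyc.ne hcz.ne' (hyc.le.trans hcz.le)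
      have hneg : y - c < 0 := sub_neg.mpr hyc
      have e : (y - c) * ((f y - f c) / (y - c)) = f y - f c := mul_div_cancel_aux _ hneg.ne
      have := mul_le_mul_of_nonpos_left hk hneg.le
      rw [e] at this
      linarith
  · by_cases hL : (F.filter (fun y => y < c)).Nonempty
    · refine ⟨(F.filter (fun y => y < c)).sup' hL (fun y => (f y - f c) / (y - c)), ?_⟩
      intro y hy _ _
      rcases lt_trichotomy c y with hcy | rfl | hyc
      · exact (hR ⟨y, by simp [hy, hcy]⟩).elim
      · simp
      · have hk : (f y - f c) / (y - c)
            ≤ (F.filter (fun y => y < c)).sup' hL (fun y => (f y - f c) / (y - c)) :=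
          le_sup' (fun y => (f y - f c) / (y - c)) (by simp [hy, hyc])
        have hneg : y - c < 0 := sub_neg.mpr hyc
        have e : (y - c) * ((f y - f c) / (y - c)) = f y - f c := mul_div_cancel_aux _ hneg.ne
        have := mul_le_mul_of_nonpos_left hk hneg.le
        rw [e] at this
        linarith
    · refine ⟨0, fun y hy _ _ => ?_⟩
      rcases lt_trichotomy c y with hcy | rfl | hyc
      · exact (hR ⟨y, by simp [hy, hcy]⟩).elim
      · simp
      · exact (hL ⟨y, by simp [hy, hyc]⟩).elim

/-- **THE CELL LINE.**  If `M` has grid supporting lines on a window with grid endpoints and `c` lies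
in the window, there is a line through `(⌊c⌋, M ⌊c⌋)` and `(⌈c⌉, M ⌈c⌉)` lying below `M` at every grid
point of the window (no grid point is strictly inside the cell, `mem_le_dn_or_up_le`). -/
theorem cell_line {F : Finset K} {lo hi : K} (hlo : lo ∈ F) (hhi : hi ∈ F) {M : K → K}
    (hM : SubgradOn F lo hi M) {c : K} (h1 : lo ≤ c) (h2 : c ≤ hi) :
    ∃ k : K, M (up F c) = M (dn F c) + (up F c - dn F c) * k ∧
      ∀ y ∈ F, lo ≤ y → y ≤ hi → M (dn F c) + (y - dn F c) * k ≤ M y := by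
  have hc : InHull F c := ⟨⟨lo, hlo, h1⟩, ⟨hi, hhi, h2⟩⟩
  have hF : F.Nonempty := ⟨lo, hlo⟩
  have hdF : dn F c ∈ F := dn_mem hF c
  have huF : up F c ∈ F := up_mem hF c
  have hlod : lo ≤ dn F c := le_dn_of_mem hlo h1
  have hdc : dn F c ≤ c := dn_le_of_inHull hc
  have hcu : c ≤ up F c := le_up_of_inHull hc
  have huhi : up F c ≤ hi := up_le_of_mem hhi h2
  have hdhi : dn F c ≤ hi := hdc.trans h2
  have hlou : lo ≤ up F c := h1.trans hcu
  obtain ⟨kd, hkd⟩ := hM (dn F c) hdF hlod hdhi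
  rcases eq_or_lt_of_le (hdc.trans hcu) with hdu | hdu
  · exact ⟨kd, by rw [← hdu]; ring, hkd⟩
  · obtain ⟨ku, hku⟩ := hM (up F c) huF hlou huhi
    have hpos : 0 < up F c - dn F c := sub_pos.mpr hdu
    have hne : up F c - dn F c ≠ 0 := hpos.ne'
    have hq : M (up F c) = M (dn F c)
        + (up F c - dn F c) * ((M (up F c) - M (dn F c)) / (up F c - dn F c)) := by
      rw [mul_div_cancel_aux _ hne]; ring
    refine ⟨(M (up F c) - M (dn F c)) / (up F c - dn F c), hq, ?_⟩
    have hkd_le : kd ≤ (M (up F c) - M (dn F c)) / (up F c - dn F c) := by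
      rw [le_div_iff₀ hpos]; have := hkd (up F c) huF hlou huhi; linarith
    have hle_ku : (M (up F c) - M (dn F c)) / (up F c - dn F c) ≤ ku := by
      rw [div_le_iff₀ hpos]; have := hku (dn F c) hdF hlod hdhi; linarith
    intro y hy hy1 hy2
    rcases mem_le_dn_or_up_le (c := c) hy with hyd | huy
    · have h := hkd y hy hy1 hy2
      have : (y - dn F c) * ((M (up F c) - M (dn F c)) / (up F c - dn F c)) ≤ (y - dn F c) * kd :=
        mul_le_mul_of_nonpos_left hkd_le (sub_nonpos.mpr hyd)
      linarith
    · have h := hku y hy hy1 hy2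
      have : (y - up F c) * ((M (up F c) - M (dn F c)) / (up F c - dn F c)) ≤ (y - up F c) * ku :=
        mul_le_mul_of_nonneg_left hle_ku (sub_nonneg.mpr huy)
      have e : M (dn F c) + (y - dn F c) * ((M (up F c) - M (dn F c)) / (up F c - dn F c))
          = M (up F c) + (y - up F c) * ((M (up F c) - M (dn F c)) / (up F c - dn F c)) := by
        linear_combination (-1 : K) * hq
      linarith

/-- Inside the cell of `c`, ONE SR STEP EVALUATES THE CELL LINE (`step_eq_affine`). -/
theorem step_eq_line {F : Finset K} {c : K} (hc : InHull F c) {M : K → K} {k : K}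
    (hku : M (up F c) = M (dn F c) + (up F c - dn F c) * k) {y : K} (h1 : dn F c ≤ y)
    (h2 : y ≤ up F c) : step F y M = M (dn F c) + (y - dn F c) * k := by
  rw [step_eq_affine hc h1 h2 M]
  rcases eq_or_lt_of_le (h1.trans h2) with hdu | hdu
  · have hy : y = dn F c := le_antisymm (hdu ▸ h2) h1
    rw [hy]; ring
  · have hne : up F c - dn F c ≠ 0 := (sub_pos.mpr hdu).ne'
    have e : (M (up F c) - M (dn F c)) / (up F c - dn F c) = k := by
      rw [hku, add_sub_cancel_left, mul_div_cancel_left₀ k hne]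
    rw [e]

/-- A line lying below `M` on the window grid lies below ONE SR STEP everywhere in the window (the
piecewise-linear interpolant of grid data dominates every such line) — `lo, hi ∈ F`. -/
theorem line_le_step {F : Finset K} {lo hi : K} (hlo : lo ∈ F) (hhi : hi ∈ F) {M : K → K}
    {d k : K} (hline : ∀ y ∈ F, lo ≤ y → y ≤ hi → M d + (y - d) * k ≤ M y) {y : K}
    (h1 : lo ≤ y) (h2 : y ≤ hi) : M d + (y - d) * k ≤ step F y M := by
  have hy : InHull F y := ⟨⟨lo, hlo, h1⟩, ⟨hi, hhi, h2⟩⟩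
  have hF : F.Nonempty := ⟨lo, hlo⟩
  have hm : pUp F y * up F y + (1 - pUp F y) * dn F y = y := by
    have h := step_id F y
    unfold step at h
    rw [clamp_eq_self hy] at h
    exact h
  have hu := hline (up F y) (up_mem hF y) (h1.trans (le_up_of_inHull hy)) (up_le_of_mem hhi h2)
  have hd := hline (dn F y) (dn_mem hF y) (le_dn_of_mem hlo h1) ((dn_le_of_inHull hy).trans h2)
  have hp0 := pUp_nonneg F y
  have hp1 := pUp_le_one F y
  unfold step
  calc M d + (y - d) * k
      = pUp F y * (M d + (up F y - d) * k) + (1 - pUp F y) * (M d + (dn F y - d) * k) := by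
        linear_combination (-k) * hm
    _ ≤ pUp F y * M (up F y) + (1 - pUp F y) * M (dn F y) :=
        add_le_add (mul_le_mul_of_nonneg_left hu hp0)
          (mul_le_mul_of_nonneg_left hd (sub_nonneg.mpr hp1))

/-- **THE ONE-STEP COMPARISON.**  If `M` has grid supporting lines on the window `[lo, hi]`
(`lo, hi ∈ F`), then for every probability vector `w` on `F` with mean `c ∈ [lo, hi]` and support
in the window, `E M(SR_F(c)) ≤ ∑ w(y) M(y)`.  (File LV `step_le_law` is the case `M` convex on `K`,
no window; here `M` need not be convex between grid points.) -/
theorem step_le_law_of_subgradOn {F : Finset K} {lo hi : K} (hlo : lo ∈ F) (hhi : hi ∈ F)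
    {M : K → K} (hM : SubgradOn F lo hi M) {w : K → K} (hw : ∀ y ∈ F, 0 ≤ w y)
    (h1 : ∑ y ∈ F, w y = 1) {c : K} (hmean : ∑ y ∈ F, w y * y = c) (hc1 : lo ≤ c) (hc2 : c ≤ hi)
    (hsupp : ∀ y ∈ F, w y ≠ 0 → lo ≤ y ∧ y ≤ hi) :
    step F c M ≤ ∑ y ∈ F, w y * M y := by
  obtain ⟨k, hku, hline⟩ := cell_line hlo hhi hM hc1 hc2
  have hc : InHull F c := ⟨⟨lo, hlo, hc1⟩, ⟨hi, hhi, hc2⟩⟩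
  rw [step_eq_line hc hku (dn_le_of_inHull hc) (le_up_of_inHull hc)]
  calc M (dn F c) + (c - dn F c) * k
      = ∑ y ∈ F, w y * (M (dn F c) + (y - dn F c) * k) := by rw [law_affine h1, hmean]
    _ ≤ ∑ y ∈ F, w y * M y := sum_le_sum fun y hy => by
        by_cases hy0 : w y = 0
        · simp [hy0]
        · obtain ⟨hy1, hy2⟩ := hsupp y hy hy0
          exact mul_le_mul_of_nonneg_left (hline y hy hy1 hy2) (hw y hy)

/-- **PROPAGATION THROUGH ONE SR STEP.**  If `M` has grid supporting lines on the window `[lo', hi']`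
(`lo', hi' ∈ F`) and `[lo + x, hi + x] ⊆ [lo', hi']`, then `y ↦ E M(SR_F(y + x))` has grid
supporting lines on `[lo, hi]`. -/
theorem subgradOn_step {F : Finset K} {lo' hi' : K} (hlo' : lo' ∈ F) (hhi' : hi' ∈ F)
    {M : K → K} (hM : SubgradOn F lo' hi' M) (x : K) {lo hi : K} (h1 : lo' ≤ lo + x)
    (h2 : hi + x ≤ hi') : SubgradOn F lo hi (fun y => step F (y + x) M) := by
  intro c _ hc1 hc2
  have hcx1 : lo' ≤ c + x := h1.trans (by linarith)
  have hcx2 : c + x ≤ hi' := le_trans (by linarith) h2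
  obtain ⟨k, hku, hline⟩ := cell_line hlo' hhi' hM hcx1 hcx2
  have hc : InHull F (c + x) := ⟨⟨lo', hlo', hcx1⟩, ⟨hi', hhi', hcx2⟩⟩
  refine ⟨k, fun y _ hy1 hy2 => ?_⟩
  have e1 : step F (c + x) M = M (dn F (c + x)) + (c + x - dn F (c + x)) * k :=
    step_eq_line hc hku (dn_le_of_inHull hc) (le_up_of_inHull hc)
  have e2 : M (dn F (c + x)) + (y + x - dn F (c + x)) * k ≤ step F (y + x) M :=
    line_le_step hlo' hhi' hline (h1.trans (by linarith)) (le_trans (by linarith) h2)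
  show step F (c + x) M + (y - c) * k ≤ step F (y + x) M
  calc step F (c + x) M + (y - c) * k = M (dn F (c + x)) + (y + x - dn F (c + x)) * k := by
        rw [e1]; ring
    _ ≤ step F (y + x) M := e2

/-- **THE INVARIANT.**  Inside a corridor, the SR cost-to-go `y ↦ E[f(ŝₙ) | ŝ₀ = y]` of a convex `f`
has a supporting line at every grid point of the initial window `[a 0, b 0]` (it is in general not
convex between grid points). -/
theorem subgradOn_accExp {F : Finset K} {f : K → K} (hf : ConvexOn K Set.univ f) :
    ∀ (n : ℕ) (a b x : ℕ → K), Corridor F a b x n →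
      SubgradOn F (a 0) (b 0) (fun y => accExp F x n f y)
  | 0, a, b, _, _ => subgradOn_of_convexOn hf F (a 0) (b 0)
  | n + 1, a, b, x, hC =>
      subgradOn_step (hC.lo_mem 1 (by omega)) (hC.hi_mem 1 (by omega))
        (subgradOn_accExp hf n _ _ _ hC.succ) (x 0) (hC.lo_step 0 (by omega))
        (hC.hi_step 0 (by omega))

/-! ### The main theorem -/

/-- **RECURSIVE SR IS OPTIMAL AMONG ALL CONDITIONALLY UNBIASED `F`-VALUED SCHEMES.**  For a convex
`f`, a corridor `(a, b)` for the summands `x`, a start `s ∈ [a 0, b 0]` and ANY admissible scheme `T`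
(arbitrary history-dependent laws on `F`, unbiased at each step, supported in the corridor):
`E_SR f(ŝₙ) = accExp F x n f s ≤ T.exp F f s = E_T f(ŝₙ)`. [new] -/
theorem accExp_le_exp {F : Finset K} {f : K → K} (hf : ConvexOn K Set.univ f) :
    ∀ (n : ℕ) (a b x : ℕ → K) (s : K) (T : Scheme K), Corridor F a b x n → a 0 ≤ s → s ≤ b 0 →
      Adm F a b x n s T → accExp F x n f s ≤ T.exp F f s
  | 0, _, _, _, _, .leaf, _, _, _, _ => le_rfl
  | 0, _, _, _, _, .node _ _, _, _, _, hA => False.elim hA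
  | _ + 1, _, _, _, _, .leaf, _, _, _, hA => False.elim hA
  | n + 1, a, b, x, s, .node w ch, hC, hs1, hs2, hA => by
      obtain ⟨hw, h1, hmean, hsupp, hch⟩ := hA
      have hC' := hC.succ
      have hm1 : a 1 ≤ s + x 0 := (hC.lo_step 0 (by omega)).trans (by linarith)
      have hm2 : s + x 0 ≤ b 1 := le_trans (by linarith) (hC.hi_step 0 (by omega))
      calc accExp F x (n + 1) f s
          = step F (s + x 0) (fun y => accExp F (fun i => x (i + 1)) n f y) := rfl
        _ ≤ ∑ y ∈ F, w y * accExp F (fun i => x (i + 1)) n f y :=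
          step_le_law_of_subgradOn (hC.lo_mem 1 (by omega)) (hC.hi_mem 1 (by omega))
            (subgradOn_accExp hf n _ _ _ hC') hw h1 hmean hm1 hm2 hsupp
        _ ≤ ∑ y ∈ F, w y * (ch y).exp F f y := sum_le_sum fun y hy => by
            by_cases hy0 : w y = 0
            · simp [hy0]
            · obtain ⟨hy1, hy2⟩ := hsupp y hy hy0
              exact mul_le_mul_of_nonneg_left
                (accExp_le_exp hf n _ _ _ y (ch y) hC' hy1 hy2 (hch y hy hy0)) (hw y hy)
        _ = (Scheme.node w ch).exp F f s := by simp [Scheme.exp]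

/-- **Error-functional form.**  For every convex `f` of the final error `ŝₙ − sₙ`,
`E_SR f(ŝₙ − sₙ) ≤ E_T f(ŝₙ − sₙ)`: variance, absolute moments, stop-loss, exponential moments … are
all minimised by SR, simultaneously. [new] -/
theorem accExp_err_le_exp_err {F : Finset K} {f : K → K} (hf : ConvexOn K Set.univ f) {n : ℕ}
    {a b x : ℕ → K} {s : K} {T : Scheme K} (hC : Corridor F a b x n) (hs1 : a 0 ≤ s)
    (hs2 : s ≤ b 0) (hA : Adm F a b x n s T) :
    accExp F x n (fun t => f (t - (s + ∑ i ∈ range n, x i))) s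
      ≤ T.exp F (fun t => f (t - (s + ∑ i ∈ range n, x i))) s :=
  accExp_le_exp (convexOn_comp_sub hf _) n a b x s T hC hs1 hs2 hA

/-- A corridor excludes saturation along the SR process (so the exact mean/variance calculus of file
XXVII applies). -/
theorem Corridor.noSat {F : Finset K} : ∀ (n : ℕ) (a b x : ℕ → K) (s : K),
    Corridor F a b x n → a 0 ≤ s → s ≤ b 0 → NoSat F x n s
  | 0, _, _, _, _, _, _, _ => trivial
  | n + 1, a, b, x, s, hC, hs1, hs2 => by
      have hm1 : a 1 ≤ s + x 0 := (hC.lo_step 0 (by omega)).trans (by linarith)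
      have hm2 : s + x 0 ≤ b 1 := le_trans (by linarith) (hC.hi_step 0 (by omega))
      have ha1 := hC.lo_mem 1 (by omega)
      have hb1 := hC.hi_mem 1 (by omega)
      have hc : InHull F (s + x 0) := ⟨⟨a 1, ha1, hm1⟩, ⟨b 1, hb1, hm2⟩⟩
      exact ⟨hc,
        Corridor.noSat n _ _ _ _ hC.succ (hm1.trans (le_up_of_inHull hc)) (up_le_of_mem hb1 hm2),
        Corridor.noSat n _ _ _ _ hC.succ (le_dn_of_mem ha1 hm1) ((dn_le_of_inHull hc).trans hm2)⟩

/-- **MSE form: SR HAS THE LEAST VARIANCE AMONG ALL CONDITIONALLY UNBIASED SCHEMES**, for every `n`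
and every input sequence: `Var_SR ŝₙ = accVar F x n s ≤ E_T (ŝₙ − sₙ)²`. [new] -/
theorem accVar_le_exp_sq {F : Finset K} {n : ℕ} {a b x : ℕ → K} {s : K} {T : Scheme K}
    (hC : Corridor F a b x n) (hs1 : a 0 ≤ s) (hs2 : s ≤ b 0) (hA : Adm F a b x n s T) :
    accVar F x n s ≤ T.exp F (fun t => (t - (s + ∑ i ∈ range n, x i)) ^ 2) s := by
  rw [← accExp_sq_sub_sum F x n s (Corridor.noSat n a b x s hC hs1 hs2)]
  exact accExp_le_exp (convexOn_sq_sub _) n a b x s T hC hs1 hs2 hA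


end Summit.Ventures.CertifiedArithmetic.LowPrec.SR
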